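import Summits.MatrixMultiplication.OmegaCensus.DicyclicN2Stable
import Summits.MatrixMultiplication.OmegaCensus.DominoStructureTPP
import HarnessLib

/-!
# Class B (`(s,s),(t,t),(u,u)`, `stu = 2k`) of the dicyclic-law triples: the even member is `ρ(c₀)`-stable, hence no
# such triple when `A/⟨c₀⟩` is a `2`-group mapping onto `𝔽₂³`

ω-census `pub-omega`, family (b3), seat pub-omega-group gen 12.  Framing: lottery ticket; floor = certified bounds/negative
ranges.  VALUE: kernel theorems about the group-theoretic method (TPP capacity of dihedral-like groups); NOT progress on ω.

Dicyclic type `G(A, c₀)` (`c₀ ≠ 0`), `π : A →+ B` with kernel `{0, c₀}`, `B` a `2`-group.  In the balanced class every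
box has the even size `stu` and every vertex has slack exactly `2`.

* `periodic_of_periodic_box_odd_odd` (+ `_mid`, `_fst`): an injective `c₀`-periodic box `X + Y + W` with two factors of
  odd size has its third factor `c₀`-periodic (the odd-weight transfer `even_of_odd_weight_convolution` of
  `DicyclicN2Stable.lean`, applied twice).
* `two_periodic_of_slack_two`: three subsets of `A` of even size, pairwise disjoint together with their `c₀`-translates
  (as the three boxes at any vertex of a TPP triple are, by the plain and the shifted disjointness relations) and of total
  size `≥ |A| − 2`, contain two `c₀`-periodic ones (the `c₀`-saturations are pairwise disjoint, so the saturation defects,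
  all even, sum to at most `2`).
* **`no_classB_dicyclic_law`**: dicyclic type, `|A| ≡ 2 (mod 3)`, `|A| ≥ 28`, `A/⟨c₀⟩ ↠ 𝔽₂³` and a `2`-group: no TPP
  triple with `|S₀| = |S₁|`, `|T₀| = |T₁|`, `|U₀| = |U₁|` attains `3|S||T||U| + 16 = 8|A|`.  (`8 ∣ |A|` makes exactly one of
  `s, t, u` even; the vertices `000` and `111` each carry two periodic boxes, which give periodic boxes on both cosets
  of the even member; the transfer makes both its parts periodic, i.e. the member is `ρ(c₀)`-stable, and
  `no_dicyclic_law_of_stable_member` concludes.)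
With P1, N1, N2, N3 (`no_two_domino_dicyclic_law_of_rank_three`, `no_n1_dicyclic_law`, `no_n2_dicyclic_law`,
`no_n3_dicyclic_law`) all five shape classes of `pub-omega-group-g11/FAMILY-B-ADDENDUM-g11.md` §2 are kernel-dead for
these quotients.
-/

namespace Summit.MatrixMultiplication.OmegaCensus

open Literature.Combinatorics.Additive Finset

/-! ## Odd-weight transfer with two odd factors; permuting the factors of a box -/

section Transfer

variable {A : Type} [AddCommGroup A] [Fintype A] [DecidableEq A] {B : Type} [AddCommGroup B] [Fintype B]
  [DecidableEq B]

omit [Fintype A] in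
/-- **A periodic box `X + Y + W` with `|X|`, `|Y|` odd has `W` periodic** (`ker π = {0,c₀}`, `c₀ ≠ 0`, `2^m · B = 0`).
[folklore] -/
theorem periodic_of_periodic_box_odd_odd (π : A →+ B) {c₀ : A} (hker : ∀ a : A, π a = 0 ↔ a = 0 ∨ a = c₀)
    (hc₀ : c₀ ≠ 0) {m : ℕ} (hB : ∀ b : B, (2 ^ m) • b = 0) {X Y W : Finset A} (hX : Odd X.card) (hY : Odd Y.card)
    (hinj : Set.InjOn (fun p : A × A × A => p.1 + p.2.1 + p.2.2) ↑(X ×ˢ Y ×ˢ W))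
    (hper : ((X ×ˢ Y ×ˢ W).image fun p : A × A × A => p.1 + p.2.1 + p.2.2).image (· + c₀) =
      (X ×ˢ Y ×ˢ W).image fun p : A × A × A => p.1 + p.2.1 + p.2.2) :
    W.image (· + c₀) = W := by
  have hπc : π c₀ = 0 := (hker c₀).2 (Or.inr rfl)
  have h2c : c₀ + c₀ = 0 := by
    rcases (hker (c₀ + c₀)).1 (by rw [map_add, hπc, add_zero]) with h' | h'
    · exact h'
    · exact absurd (add_eq_left.1 h') hc₀
  set H : B → ℕ := fun b => (W.filter fun w => π w = b).card with hH
  set H₂ : B → ℕ := fun z => ∑ y ∈ Y, H (z - π y) with hH₂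
  have hev : ∀ t : B, 2 ∣ ∑ x ∈ X, H₂ (t - π x) := by
    intro t
    have := even_card_fibre_of_periodic π hπc hc₀ h2c hper t
    rw [card_fibre_box_eq_sum π hinj] at this
    simpa only [hH₂, hH] using this
  have hev₂ : ∀ z : B, 2 ∣ ∑ y ∈ Y, H (z - π y) := even_of_odd_weight_convolution π hB hX H₂ hev
  exact periodic_of_even_fibres π hker hc₀ (even_of_odd_weight_convolution π hB hY H hev₂)

omit [Fintype A] in
/-- Swapping the last two factors of a box. [folklore] -/
theorem sumset₃_swap₂₃ (X Y W : Finset A) :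
    ((X ×ˢ Y ×ˢ W).image fun p : A × A × A => p.1 + p.2.1 + p.2.2) =
      (X ×ˢ W ×ˢ Y).image fun p : A × A × A => p.1 + p.2.1 + p.2.2 := by
  ext x
  rw [mem_sumset₃, mem_sumset₃]
  constructor
  · rintro ⟨a, ha, b, hb, c, hc, rfl⟩; exact ⟨a, ha, c, hc, b, hb, by abel⟩
  · rintro ⟨a, ha, c, hc, b, hb, rfl⟩; exact ⟨a, ha, b, hb, c, hc, by abel⟩

omit [Fintype A] in
/-- Rotating the factors of a box. [folklore] -/
theorem sumset₃_rotate (X Y W : Finset A) :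
    ((X ×ˢ Y ×ˢ W).image fun p : A × A × A => p.1 + p.2.1 + p.2.2) =
      (Y ×ˢ W ×ˢ X).image fun p : A × A × A => p.1 + p.2.1 + p.2.2 := by
  ext x
  rw [mem_sumset₃, mem_sumset₃]
  constructor
  · rintro ⟨a, ha, b, hb, c, hc, rfl⟩; exact ⟨b, hb, c, hc, a, ha, by abel⟩
  · rintro ⟨b, hb, c, hc, a, ha, rfl⟩; exact ⟨a, ha, b, hb, c, hc, by abel⟩

omit [Fintype A] in
/-- Injectivity of a box transfers to a permuted box with the same image. [folklore] -/
theorem injOn_of_card_box {X Y W : Finset A}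
    (hc : ((X ×ˢ Y ×ˢ W).image fun p : A × A × A => p.1 + p.2.1 + p.2.2).card = X.card * Y.card * W.card) :
    Set.InjOn (fun p : A × A × A => p.1 + p.2.1 + p.2.2) ↑(X ×ˢ Y ×ˢ W) := by
  apply card_image_iff.1
  rw [hc, card_product, card_product, mul_assoc]

omit [Fintype A] in
/-- The transfer for the middle factor: `|X|`, `|W|` odd forces `Y` periodic. [folklore] -/
theorem periodic_mid_of_periodic_box (π : A →+ B) {c₀ : A} (hker : ∀ a : A, π a = 0 ↔ a = 0 ∨ a = c₀)
    (hc₀ : c₀ ≠ 0) {m : ℕ} (hB : ∀ b : B, (2 ^ m) • b = 0) {X Y W : Finset A} (hX : Odd X.card) (hW : Odd W.card)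
    (hinj : Set.InjOn (fun p : A × A × A => p.1 + p.2.1 + p.2.2) ↑(X ×ˢ Y ×ˢ W))
    (hper : ((X ×ˢ Y ×ˢ W).image fun p : A × A × A => p.1 + p.2.1 + p.2.2).image (· + c₀) =
      (X ×ˢ Y ×ˢ W).image fun p : A × A × A => p.1 + p.2.1 + p.2.2) :
    Y.image (· + c₀) = Y := by
  have hc : ((X ×ˢ Y ×ˢ W).image fun p : A × A × A => p.1 + p.2.1 + p.2.2).card = X.card * Y.card * W.card := by
    rw [card_image_of_injOn hinj, card_product, card_product, mul_assoc]
  rw [sumset₃_swap₂₃] at hper hc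
  exact periodic_of_periodic_box_odd_odd π hker hc₀ hB hX hW
    (injOn_of_card_box (by rw [hc]; ring)) hper

omit [Fintype A] in
/-- The transfer for the first factor: `|Y|`, `|W|` odd forces `X` periodic. [folklore] -/
theorem periodic_fst_of_periodic_box (π : A →+ B) {c₀ : A} (hker : ∀ a : A, π a = 0 ↔ a = 0 ∨ a = c₀)
    (hc₀ : c₀ ≠ 0) {m : ℕ} (hB : ∀ b : B, (2 ^ m) • b = 0) {X Y W : Finset A} (hY : Odd Y.card) (hW : Odd W.card)
    (hinj : Set.InjOn (fun p : A × A × A => p.1 + p.2.1 + p.2.2) ↑(X ×ˢ Y ×ˢ W))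
    (hper : ((X ×ˢ Y ×ˢ W).image fun p : A × A × A => p.1 + p.2.1 + p.2.2).image (· + c₀) =
      (X ×ˢ Y ×ˢ W).image fun p : A × A × A => p.1 + p.2.1 + p.2.2) :
    X.image (· + c₀) = X := by
  have hc : ((X ×ˢ Y ×ˢ W).image fun p : A × A × A => p.1 + p.2.1 + p.2.2).card = X.card * Y.card * W.card := by
    rw [card_image_of_injOn hinj, card_product, card_product, mul_assoc]
  rw [sumset₃_rotate] at hper hc
  exact periodic_of_periodic_box_odd_odd π hker hc₀ hB hY hW
    (injOn_of_card_box (by rw [hc]; ring)) hper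

end Transfer

/-! ## Slack two forces two periodic boxes -/

section Slack

variable {A : Type} [AddCommGroup A] [Fintype A] [DecidableEq A]

omit [Fintype A] in
/-- The `c₀`-saturation `X ⊔ (X + c₀)` is `c₀`-periodic (`2c₀ = 0`). [folklore] -/
theorem saturate_periodic (X : Finset A) {c₀ : A} (h2c : c₀ + c₀ = 0) :
    (X ∪ X.image (· + c₀)).image (· + c₀) = X ∪ X.image (· + c₀) := by
  rw [image_union, image_add_image, h2c, image_add_zero', union_comm]

omit [Fintype A] in
/-- Saturations of sets that are disjoint together with their translates are disjoint. [folklore] -/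
theorem disjoint_saturate {X Y : Finset A} {c₀ : A} (h2c : c₀ + c₀ = 0) (h : Disjoint X Y)
    (hs : Disjoint X (Y.image (· + c₀))) : Disjoint (X ∪ X.image (· + c₀)) (Y ∪ Y.image (· + c₀)) := by
  rw [disjoint_union_left, disjoint_union_right, disjoint_union_right]
  exact ⟨⟨h, hs⟩, ⟨disjoint_image_add_comm h2c hs, (disjoint_image_add c₀).2 h⟩⟩

omit [Fintype A] in
/-- A set whose saturation is no bigger is periodic. [folklore] -/
theorem periodic_of_card_saturate_le {X : Finset A} {c₀ : A} (h : (X ∪ X.image (· + c₀)).card ≤ X.card) :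
    X.image (· + c₀) = X := by
  have heq : X ∪ X.image (· + c₀) = X := (eq_of_subset_of_card_le subset_union_left h).symm
  apply eq_of_subset_of_card_le _ (by rw [card_image_add])
  intro x hx
  rw [← heq]
  exact mem_union_right _ hx

/-- **Slack two forces two periodic boxes.**  `c₀ ≠ 0`, `2c₀ = 0`; `X, Y, Z ⊆ A` of even sizes with
`|A| ≤ |X| + |Y| + |Z| + 2`, pairwise disjoint and disjoint from each other's `c₀`-translates.  Then two of the three
are `c₀`-periodic. [folklore] -/
theorem two_periodic_of_slack_two {X Y Z : Finset A} {c₀ : A} (hc₀ : c₀ ≠ 0) (h2c : c₀ + c₀ = 0)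
    (hXY : Disjoint X Y) (hXZ : Disjoint X Z) (hYZ : Disjoint Y Z)
    (sXY : Disjoint X (Y.image (· + c₀))) (sXZ : Disjoint X (Z.image (· + c₀))) (sYZ : Disjoint Y (Z.image (· + c₀)))
    (eX : 2 ∣ X.card) (eY : 2 ∣ Y.card) (eZ : 2 ∣ Z.card)
    (hslack : Fintype.card A ≤ X.card + Y.card + Z.card + 2) :
    (X.image (· + c₀) = X ∧ Y.image (· + c₀) = Y) ∨ (X.image (· + c₀) = X ∧ Z.image (· + c₀) = Z) ∨
      (Y.image (· + c₀) = Y ∧ Z.image (· + c₀) = Z) := by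
  set X' := X ∪ X.image (· + c₀) with hX'
  set Y' := Y ∪ Y.image (· + c₀) with hY'
  set Z' := Z ∪ Z.image (· + c₀) with hZ'
  have dXY : Disjoint X' Y' := disjoint_saturate h2c hXY sXY
  have dXZ : Disjoint X' Z' := disjoint_saturate h2c hXZ sXZ
  have dYZ : Disjoint Y' Z' := disjoint_saturate h2c hYZ sYZ
  have hle : X'.card + Y'.card + Z'.card ≤ Fintype.card A := by
    rw [← card_union_of_disjoint dXY, ← card_union_of_disjoint (disjoint_union_left.2 ⟨dXZ, dYZ⟩)]
    exact card_le_univ _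
  have pX : 2 ∣ X'.card := card_even_of_periodic (saturate_periodic X h2c) hc₀ h2c
  have pY : 2 ∣ Y'.card := card_even_of_periodic (saturate_periodic Y h2c) hc₀ h2c
  have pZ : 2 ∣ Z'.card := card_even_of_periodic (saturate_periodic Z h2c) hc₀ h2c
  have lX : X.card ≤ X'.card := card_le_card subset_union_left
  have lY : Y.card ≤ Y'.card := card_le_card subset_union_left
  have lZ : Z.card ≤ Z'.card := card_le_card subset_union_left
  obtain ⟨a, ha⟩ := pX; obtain ⟨b, hb⟩ := pY; obtain ⟨c, hc⟩ := pZ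
  obtain ⟨a', ha'⟩ := eX; obtain ⟨b', hb'⟩ := eY; obtain ⟨c', hc'⟩ := eZ
  by_cases hx : X'.card ≤ X.card
  · by_cases hy : Y'.card ≤ Y.card
    · exact Or.inl ⟨periodic_of_card_saturate_le hx, periodic_of_card_saturate_le hy⟩
    · have hz : Z'.card ≤ Z.card := by omega
      exact Or.inr (Or.inl ⟨periodic_of_card_saturate_le hx, periodic_of_card_saturate_le hz⟩)
  · have hy : Y'.card ≤ Y.card := by omega
    have hz : Z'.card ≤ Z.card := by omega
    exact Or.inr (Or.inr ⟨periodic_of_card_saturate_le hy, periodic_of_card_saturate_le hz⟩)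

end Slack

/-! ## Class B -/

section ClassB

variable {A : Type} [AddCommGroup A] [DecidableEq A] [Fintype A] {G : Type} [Group G] [DecidableEq G]
  {ρ τ : A → G} {c₀ : A} {B : Type} [AddCommGroup B] [DecidableEq B] [Fintype B]

/-- **The even member of a class-B triple is `ρ(c₀)`-stable.**  Dicyclic type, `π : A →+ B` with kernel `{0,c₀}`,
`B` a `2`-group; a TPP triple with `|S₀| = |S₁| = s`, `|T₀| = |T₁| = t`, `|U₀| = |U₁| = u`, `|A| ≤ 3stu + 2`, `s, t` odd
and `u` even.  Then `U₀ + c₀ = U₀` and `U₁ + c₀ = U₁`. [folklore] -/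
theorem classB_parts_periodic
    (hρρ : ∀ a b, ρ a * ρ b = ρ (a + b)) (hρτ : ∀ a b, ρ a * τ b = τ (b - a))
    (hτρ : ∀ a b, τ a * ρ b = τ (a + b)) (hττ : ∀ a b, τ a * τ b = ρ (c₀ + b - a)) (hc₀ : c₀ ≠ 0)
    (hρ : Function.Injective ρ) (hτ : Function.Injective τ) (hne : ∀ a b, ρ a ≠ τ b)
    (π : A →+ B) (hker : ∀ a : A, π a = 0 ↔ a = 0 ∨ a = c₀) {m : ℕ} (hB : ∀ b : B, (2 ^ m) • b = 0)
    {S T U : Finset G} (h : TripleProductProperty S T U) {s t u : ℕ}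
    (hs₀ : (univ.filter fun a : A => ρ a ∈ S).card = s) (hs₁ : (univ.filter fun a : A => τ a ∈ S).card = s)
    (ht₀ : (univ.filter fun a : A => ρ a ∈ T).card = t) (ht₁ : (univ.filter fun a : A => τ a ∈ T).card = t)
    (hu₀ : (univ.filter fun a : A => ρ a ∈ U).card = u) (hu₁ : (univ.filter fun a : A => τ a ∈ U).card = u)
    (hs : Odd s) (ht : Odd t) (hu : Even u) (hA : Fintype.card A ≤ 3 * (s * t * u) + 2) :
    (univ.filter fun a : A => ρ a ∈ U).image (· + c₀) = (univ.filter fun a : A => ρ a ∈ U) ∧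
    (univ.filter fun a : A => τ a ∈ U).image (· + c₀) = (univ.filter fun a : A => τ a ∈ U) := by
  set S₀ : Finset A := univ.filter fun a => ρ a ∈ S with hS₀
  set S₁ : Finset A := univ.filter fun a => τ a ∈ S with hS₁
  set T₀ : Finset A := univ.filter fun a => ρ a ∈ T with hT₀
  set T₁ : Finset A := univ.filter fun a => τ a ∈ T with hT₁
  set U₀ : Finset A := univ.filter fun a => ρ a ∈ U with hU₀
  set U₁ : Finset A := univ.filter fun a => τ a ∈ U with hU₁
  have h2c := two_c0_eq_zero hρτ hτρ hττ hτ
  have mS₀ : ∀ a ∈ S₀, cond false (τ a) (ρ a) ∈ S := fun a ha => by simpa [hS₀] using ha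
  have mS₁ : ∀ a ∈ S₁, cond true (τ a) (ρ a) ∈ S := fun a ha => by simpa [hS₁] using ha
  have mT₀ : ∀ a ∈ T₀, cond false (τ a) (ρ a) ∈ T := fun a ha => by simpa [hT₀] using ha
  have mT₁ : ∀ a ∈ T₁, cond true (τ a) (ρ a) ∈ T := fun a ha => by simpa [hT₁] using ha
  have mU₀ : ∀ a ∈ U₀, cond false (τ a) (ρ a) ∈ U := fun a ha => by simpa [hU₀] using ha
  have mU₁ : ∀ a ∈ U₁, cond true (τ a) (ρ a) ∈ U := fun a ha => by simpa [hU₁] using ha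
  have mT₀' : ∀ a ∈ T₀, ρ a ∈ T := fun a ha => (mem_filter.1 ha).2
  have mT₁' : ∀ a ∈ T₁, τ a ∈ T := fun a ha => (mem_filter.1 ha).2
  have mS₀' : ∀ a ∈ S₀, ρ a ∈ S := fun a ha => (mem_filter.1 ha).2
  have mS₁' : ∀ a ∈ S₁, τ a ∈ S := fun a ha => (mem_filter.1 ha).2
  have mU₀' : ∀ a ∈ U₀, ρ a ∈ U := fun a ha => (mem_filter.1 ha).2
  have mU₁' : ∀ a ∈ U₁, τ a ∈ U := fun a ha => (mem_filter.1 ha).2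
  have cs := card_sumset' hρρ hττ hρ hτ h
  have inj := sum_injOn' hρρ hττ hρ hτ h
  have oS₀ : Odd S₀.card := by rw [hs₀]; exact hs
  have oS₁ : Odd S₁.card := by rw [hs₁]; exact hs
  have oT₀ : Odd T₀.card := by rw [ht₀]; exact ht
  have oT₁ : Odd T₁.card := by rw [ht₁]; exact ht
  obtain ⟨u', hu'⟩ := hu
  have ev : 2 ∣ s * t * u := ⟨s * t * u', by rw [hu']; ring⟩
  -- the boxes
  set B100 := (S₁ ×ˢ T₀ ×ˢ U₀).image fun p : A × A × A => p.1 + p.2.1 + p.2.2 with hB100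
  set B010 := (S₀ ×ˢ T₁ ×ˢ U₀).image fun p : A × A × A => p.1 + p.2.1 + p.2.2 with hB010
  set B001 := (S₀ ×ˢ T₀ ×ˢ U₁).image fun p : A × A × A => p.1 + p.2.1 + p.2.2 with hB001
  set B011 := (S₀ ×ˢ T₁ ×ˢ U₁).image fun p : A × A × A => p.1 + p.2.1 + p.2.2 with hB011
  set B101 := (S₁ ×ˢ T₀ ×ˢ U₁).image fun p : A × A × A => p.1 + p.2.1 + p.2.2 with hB101
  set B110 := (S₁ ×ˢ T₁ ×ˢ U₀).image fun p : A × A × A => p.1 + p.2.1 + p.2.2 with hB110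
  have c100 : B100.card = s * t * u := by rw [hB100, cs true false false mS₁ mT₀ mU₀, hs₁, ht₀, hu₀]
  have c010 : B010.card = s * t * u := by rw [hB010, cs false true false mS₀ mT₁ mU₀, hs₀, ht₁, hu₀]
  have c001 : B001.card = s * t * u := by rw [hB001, cs false false true mS₀ mT₀ mU₁, hs₀, ht₀, hu₁]
  have c011 : B011.card = s * t * u := by rw [hB011, cs false true true mS₀ mT₁ mU₁, hs₀, ht₁, hu₁]
  have c101 : B101.card = s * t * u := by rw [hB101, cs true false true mS₁ mT₀ mU₁, hs₁, ht₀, hu₁]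
  have c110 : B110.card = s * t * u := by rw [hB110, cs true true false mS₁ mT₁ mU₀, hs₁, ht₁, hu₀]
  -- disjointness, plain and shifted, at the vertices `000` and `111`
  have d₁ : Disjoint B100 B010 := (disjoint_sumset₁' hρρ hρτ hτρ hττ hne h) false mS₁' mT₀' mU₀ mS₀' mT₁'
  have d₂ : Disjoint B010 B001 := (disjoint_sumset₂' hρρ hρτ hτρ hττ hne h) false mS₀ mT₁' mU₀' mS₀ mT₀' mU₁'
  have d₃ : Disjoint B001 B100 := (disjoint_sumset₃' hρρ hρτ hτρ hττ hne h) false mS₀' mT₀ mU₁' mS₁' mU₀'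
  have sh₁ : Disjoint B100 (B010.image (· + c₀)) :=
    (disjoint_sumset₁_shift' hρρ hρτ hττ hne h) false mS₁' mT₀' mU₀ mS₀' mT₁'
  have sh₂ : Disjoint (B001.image (· + c₀)) B010 :=
    (disjoint_sumset₂_shift' hρρ hρτ hττ hne h) false mS₀ mT₀' mU₁' mS₀ mT₁' mU₀'
  have sh₃ : Disjoint B100 (B001.image (· + c₀)) :=
    (disjoint_sumset₃_shift' hρρ hρτ hτρ hττ hne h) false mS₁' mT₀ mU₀' mS₀' mU₁'
  have d₁' : Disjoint B101 B011 := (disjoint_sumset₁' hρρ hρτ hτρ hττ hne h) true mS₁' mT₀' mU₁ mS₀' mT₁'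
  have d₂' : Disjoint B110 B101 := (disjoint_sumset₂' hρρ hρτ hτρ hττ hne h) true mS₁ mT₁' mU₀' mS₁ mT₀' mU₁'
  have d₃' : Disjoint B011 B110 := (disjoint_sumset₃' hρρ hρτ hτρ hττ hne h) true mS₀' mT₁ mU₁' mS₁' mU₀'
  have sh₁' : Disjoint B101 (B011.image (· + c₀)) :=
    (disjoint_sumset₁_shift' hρρ hρτ hττ hne h) true mS₁' mT₀' mU₁ mS₀' mT₁'
  have sh₂' : Disjoint (B101.image (· + c₀)) B110 :=
    (disjoint_sumset₂_shift' hρρ hρτ hττ hne h) true mS₁ mT₀' mU₁' mS₁ mT₁' mU₀'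
  have sh₃' : Disjoint B110 (B011.image (· + c₀)) :=
    (disjoint_sumset₃_shift' hρρ hρτ hτρ hττ hne h) true mS₁' mT₁ mU₀' mS₀' mU₁'
  -- two periodic boxes at each of the two vertices
  have v000 := two_periodic_of_slack_two hc₀ h2c d₁ d₃.symm d₂ sh₁ sh₃ sh₂.symm
    (by rw [c100]; exact ev) (by rw [c010]; exact ev) (by rw [c001]; exact ev) (by rw [c100, c010, c001]; omega)
  have v111 := two_periodic_of_slack_two hc₀ h2c d₁' d₂'.symm d₃' sh₁'
    (disjoint_image_add_comm h2c sh₂'.symm).symm (disjoint_image_add_comm h2c sh₃').symm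
    (by rw [c101]; exact ev) (by rw [c011]; exact ev) (by rw [c110]; exact ev) (by rw [c101, c011, c110]; omega)
  -- a periodic box on each coset of `U`
  have hU₀ : U₀.image (· + c₀) = U₀ := by
    rcases v000 with ⟨p, -⟩ | ⟨p, -⟩ | ⟨p, -⟩
    · exact periodic_of_periodic_box_odd_odd π hker hc₀ hB oS₁ oT₀ (inj true false false mS₁ mT₀ mU₀) p
    · exact periodic_of_periodic_box_odd_odd π hker hc₀ hB oS₁ oT₀ (inj true false false mS₁ mT₀ mU₀) p
    · exact periodic_of_periodic_box_odd_odd π hker hc₀ hB oS₀ oT₁ (inj false true false mS₀ mT₁ mU₀) p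
  have hU₁ : U₁.image (· + c₀) = U₁ := by
    rcases v111 with ⟨p, -⟩ | ⟨p, -⟩ | ⟨p, -⟩
    · exact periodic_of_periodic_box_odd_odd π hker hc₀ hB oS₁ oT₀ (inj true false true mS₁ mT₀ mU₁) p
    · exact periodic_of_periodic_box_odd_odd π hker hc₀ hB oS₁ oT₀ (inj true false true mS₁ mT₀ mU₁) p
    · exact periodic_of_periodic_box_odd_odd π hker hc₀ hB oS₀ oT₁ (inj false true true mS₀ mT₁ mU₁) p
  exact ⟨hU₀, hU₁⟩

/-- **No class-B dicyclic-law triple when `A/⟨c₀⟩` is a `2`-group mapping onto `𝔽₂³`.**  Dicyclic type (`c₀ ≠ 0`),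
`|A| ≡ 2 (mod 3)`, `|A| ≥ 28`, three homomorphisms `A →+ ZMod 2` killing `c₀` jointly onto `𝔽₂³`, `π : A →+ B` with kernel
`{0, c₀}`, `2^m · B = 0`.  Then no TPP triple with balanced parts `|S₀| = |S₁|`, `|T₀| = |T₁|`, `|U₀| = |U₁|` attains
`3|S||T||U| + 16 = 8|A|`.  (The law gives `|A| = 3stu + 2`; `8 ∣ |A|` makes exactly one of `s, t, u` even; after a cyclic
rotation of the triple the even member is `U`, `classB_parts_periodic` makes it `ρ(c₀)`-stable and
`no_dicyclic_law_of_stable_member` concludes.) [folklore] -/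
theorem no_classB_dicyclic_law
    (hρρ : ∀ a b, ρ a * ρ b = ρ (a + b)) (hρτ : ∀ a b, ρ a * τ b = τ (b - a))
    (hτρ : ∀ a b, τ a * ρ b = τ (a + b)) (hττ : ∀ a b, τ a * τ b = ρ (c₀ + b - a)) (hc₀ : c₀ ≠ 0)
    (hρ : Function.Injective ρ) (hτ : Function.Injective τ) (hne : ∀ a b, ρ a ≠ τ b)
    (hsurj : ∀ g, (∃ a, ρ a = g) ∨ (∃ a, τ a = g)) (hmod : Fintype.card A % 3 = 2) (hA : 28 ≤ Fintype.card A)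
    (ψ₁ ψ₂ ψ₃ : A →+ ZMod 2) (hψc : ψ₁ c₀ = 0 ∧ ψ₂ c₀ = 0 ∧ ψ₃ c₀ = 0)
    (hψ : ∀ v : ZMod 2 × ZMod 2 × ZMod 2, ∃ x, (ψ₁ x, ψ₂ x, ψ₃ x) = v)
    (π : A →+ B) (hker : ∀ a : A, π a = 0 ↔ a = 0 ∨ a = c₀) {m : ℕ} (hB : ∀ b : B, (2 ^ m) • b = 0)
    {S T U : Finset G} (h : TripleProductProperty S T U)
    (hs : (univ.filter fun a : A => ρ a ∈ S).card = (univ.filter fun a : A => τ a ∈ S).card)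
    (ht : (univ.filter fun a : A => ρ a ∈ T).card = (univ.filter fun a : A => τ a ∈ T).card)
    (hu : (univ.filter fun a : A => ρ a ∈ U).card = (univ.filter fun a : A => τ a ∈ U).card) :
    3 * (S.card * T.card * U.card) + 16 ≠ 8 * Fintype.card A := by
  intro hV
  have h2c := two_c0_eq_zero hρτ hτρ hττ hτ
  set s := (univ.filter fun a : A => ρ a ∈ S).card with hsd
  set t := (univ.filter fun a : A => ρ a ∈ T).card with htd
  set u := (univ.filter fun a : A => ρ a ∈ U).card with hud
  have cS : S.card = s + s := by rw [card_eq_parts' hρ hτ hne hsurj S, ← hs]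
  have cT : T.card = t + t := by rw [card_eq_parts' hρ hτ hne hsurj T, ← ht]
  have cU : U.card = u + u := by rw [card_eq_parts' hρ hτ hne hsurj U, ← hu]
  have hV' := hV
  rw [cS, cT, cU, show (s + s) * (t + t) * (u + u) = 8 * (s * t * u) by ring] at hV'
  have hN : Fintype.card A = 3 * (s * t * u) + 2 := by omega
  obtain ⟨q, hq⟩ := eight_dvd_card_of_onto ψ₁ ψ₂ ψ₃ hψ
  have hP : s * t * u % 8 = 2 := by omega
  -- which member is even
  have key : ∃ a : A, a + a = 0 ∧ a ≠ 0 ∧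
      ((∀ x ∈ S, x * ρ a ∈ S) ∨ (∀ x ∈ T, x * ρ a ∈ T) ∨ (∀ x ∈ U, x * ρ a ∈ U)) := by
    refine ⟨c₀, h2c, hc₀, ?_⟩
    rcases Nat.even_or_odd s with hse | hso <;> rcases Nat.even_or_odd t with hte | hto <;>
      rcases Nat.even_or_odd u with hue | huo
    · exfalso; obtain ⟨a, ha⟩ := hse; obtain ⟨b, hb⟩ := hte
      rw [ha, hb, show (a + a) * (b + b) * u = 4 * (a * b * u) by ring] at hP; omega
    · exfalso; obtain ⟨a, ha⟩ := hse; obtain ⟨b, hb⟩ := hte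
      rw [ha, hb, show (a + a) * (b + b) * u = 4 * (a * b * u) by ring] at hP; omega
    · exfalso; obtain ⟨a, ha⟩ := hse; obtain ⟨b, hb⟩ := hue
      rw [ha, hb, show (a + a) * t * (b + b) = 4 * (a * t * b) by ring] at hP; omega
    · -- `s` even: rotate to `(T, U, S)`
      left
      obtain ⟨p₀, p₁⟩ := classB_parts_periodic hρρ hρτ hτρ hττ hc₀ hρ hτ hne π hker hB h.rotate htd.symm ht.symm
        hud.symm hu.symm hsd.symm hs.symm hto huo hse
        (by rw [hN, show t * u * s = s * t * u by ring])
      exact stable_of_parts_periodic hρρ hτρ hsurj p₀ p₁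
    · exfalso; obtain ⟨a, ha⟩ := hte; obtain ⟨b, hb⟩ := hue
      rw [ha, hb, show s * (a + a) * (b + b) = 4 * (s * a * b) by ring] at hP; omega
    · -- `t` even: rotate to `(U, S, T)`
      right; left
      obtain ⟨p₀, p₁⟩ := classB_parts_periodic hρρ hρτ hτρ hττ hc₀ hρ hτ hne π hker hB h.rotate.rotate hud.symm
        hu.symm hsd.symm hs.symm htd.symm ht.symm huo hso hte
        (by rw [hN, show u * s * t = s * t * u by ring])
      exact stable_of_parts_periodic hρρ hτρ hsurj p₀ p₁
    · -- `u` even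
      right; right
      obtain ⟨p₀, p₁⟩ := classB_parts_periodic hρρ hρτ hτρ hττ hc₀ hρ hτ hne π hker hB h hsd.symm hs.symm
        htd.symm ht.symm hud.symm hu.symm hso hto hue (by rw [hN])
      exact stable_of_parts_periodic hρρ hτρ hsurj p₀ p₁
    · exfalso
      have hodd : Odd (s * t * u) := (hso.mul hto).mul huo
      obtain ⟨r, hr⟩ := hodd
      omega
  obtain ⟨a, ha2, ha0, hstab⟩ := key
  exact no_dicyclic_law_of_stable_member hρρ hρτ hτρ hττ hc₀ hρ hτ hne hsurj hmod hA ψ₁ ψ₂ ψ₃ hψc hψ h ha2 ha0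
    hstab hV

end ClassB

end Summit.MatrixMultiplication.OmegaCensus
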